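import Summits.QuantumFields.YangMills.Theorems.UnitScaleTiltProp8FlatOpsLettersAssembly
import Summits.QuantumFields.YangMills.Theorems.UnitScaleTiltProp8FlatOpsFromKernelRows
import Literature.MathematicalPhysics.QuantumFieldTheory.Balaban1983to89.B6GlobalChartV1
import Literature.MathematicalPhysics.QuantumFieldTheory.Balaban1983to89.T4Continuum
import HarnessLib

/-!
# K0⁷ `stub_prop8StepCoP13` (stmt-QuantumFields-20541), sub-target S5 ((160)–(164) of [Balaban1985Variational] Sect. F), S5 ROAD item (a):
# **THE P2 LETTER SCHEMAS OF `UnitScaleTiltProp8FlatCubeOpsText` RE-TYPED GENERIC IN THE CARRIER `P : Params`** — so that the T⁴ editions NODE 00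
# needs are the instances `P := F.P K` (`F : T4Family`), and lit-balaban's d-generic k-level rows ([Balaban1984PropagatorsII] Cor. 2.8 on the tori
# `B6GlobalChartV1.PV d ℓ m K`) meet them at `PV 3 ℓ m K = T4Family.P ⟨ℓ+1, …⟩ K` (`P_mk_eq_PV`, by `rfl`)

Cell `pub-ymgap`, width seat `pub-ymgap-k0-s1-w3` gen 2 (D-0149; START LIST v7 §k0-s1 «S5 ROAD LOCATED … UNOWNED ×3», item (a), plan g80 WORDS-1b).
`--kind definition --supports stmt-QuantumFields-20541 --as helper`; count-neutral.  DEFINITIONS (Prop-valued schemas + the two canonical plain-function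
operators `flatH`, `gtOf`) and `rfl`-bridges ONLY; NOTHING of Bałaban's analysis is asserted or proved here.

WHY.  The ym3-torus cell typed [Balaban1985Variational] (46), (161)₁, (162), (165) as LETTER SCHEMAS for the canonical flat operators `H = GQ*(QGQ*)⁻¹`, `G̃ = G − HQG`
of a nested family `D : Domains (F.P K)` (`FlatCubeOpsText`, `FlatOpsLettersAssembly`, `FlatOpsHRowsFromKernels.HKernelRows`, `FlatOpsFromKernelRows.KernelRowsAt`) over
`F : T3Family`, directions `Fin 3`.  Every ingredient (`Domains`, `BondIdx`, `QE`, `QsE`, `GE`, `EE`, `hOp`, `dcE`, `dcsE`, `levOf`, `distSite`, `Adm22`, `distBI`, `Qfun`)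
is ALREADY generic in `P : Params`; only the binder `(F : T3Family) (n K : ℕ)` and the literal `Fin 3` are not.  NODE 00's record lives on the T⁴ tori
`T4Family.P K = Missing.params4 …` ([Balaban1987RG1] (0.1)); the SUPPLIER of the letters' content — lit-balaban's hypothesis-free k-level Cor. 2.8
`B6Cor28EntriesKLevelV1L0.cor28_kLevel_H_DH (d ℓ : ℕ) …` — is generic in `d` on the tori `PV d ℓ m K`.  This is the ONE definer file both meet: the same schemas with
`(P : Params) (k : ℕ)` for `(F : T3Family) (n K : ℕ)` (`k` = the height `K − n`, `η⁻¹ = P.L ^ k`, directions `Fin P.d`); §5 recovers the d = 3 letters BY `Iff.rfl`,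
§6 identifies the d = 4 carrier by `rfl`.  DEFINED (§1–§3): `IsLevWeight` · `IsFlatH` · `IsFlatGt` · `flatH` · `IsFlatGW` · `gtOf` · `HSupLetterG` (46) · `HDecayLetterD`
(161)₁ ×4 · `RowSum162` (162) · `HLapLetterG` (130) · `GtSupLetterG` · `GtLaplaceLetterG` (165) · `QContrLetter` · `HKernelRows` · `KernelRowsAt` · `RowsAt` · `HRowsAt`
(the `H`-half of `RowsAt`: what S5 consumes) · `BodyAt` (the `∃ H G̃ … ∃ dBI …` clause of `FlatOpsAdmAtMS` at one datum); §7 nonnegativity ∕ monotonicity bookkeeping.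

HONEST FRAMING: count-neutral helper; K0⁷ OPEN; N07 NOT discharged (5∕27 unmoved); one finite 𝕋⁴ programme at fixed ε — R4 closes the conditional finite-𝕋⁴ rung
`BalabanLadder.UV` only; the YM mass gap (Clay) is NOT proved by any of this; nothing continuum ∕ ℝ⁴ ∕ OS.  No `sorry`, no `instance`, no `notation`.
References: T. Bałaban, CMP **102** (1985) 277–309 [Balaban1985Variational] (45)–(46) p.285, (130) p.298, (139)–(140) p.299, (143) p.300, (157)–(158) p.302, (161)–(163)
p.303, (165) p.304; CMP **96** (1984) 223–250 [Balaban1984PropagatorsII] (2.16) p.225, (2.20) p.226, (2.35) p.228, (2.46) p.231, Prop. 2.6 (2.136) p.247, Cor. 2.8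
(2.150)–(2.151) p.249; CMP **109** (1987) 249–301 [Balaban1987RG1] (0.1) p.251.
-/

set_option autoImplicit false

noncomputable section

open scoped BigOperators

namespace Summit.QuantumFields.YangMills.Theorems.K0FlatCubeOpsTextP

open Literature.MathematicalPhysics.QuantumFieldTheory.Balaban1983to89
open B6SectADomainsV1 (Domains)
open B6SectAOperatorsV1 (BondIdx BondIdxSpace QE QsE dcE dcsE)
open B6SectAVectorModelV1 (GE EE)
open B6SectA (hOp)
open B6GlobalChartV1 (PV)
open B11Eq115Space (levOf)
open T3ContinuumYM3Torus (T3Family)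
open T4Continuum (T4Family)
open FlatCubeOpsText (Adm22 distBI)
open FlatOpsLettersAssembly (Qfun)

/-! ## §1 Pinning: the level weights and the canonical operators, generic carrier -/

section Pinning

variable (P : Params) (k : ℕ) (D : Domains P)

/-- **THE LEVEL WEIGHTS** `w m b = (L^{j(b₋)}η)^m`, `η = L^{−k}`, `j = levOf (i ↦ {x | x ∈ Bⁱ(Ω_i^{(i)})}) k` — `FlatCubeOpsText.IsLevWeight` with the carrier generalised
(`F.P K ↦ P`, `K − n ↦ k`; instantiate by `rfl`). [cite: Balaban1985Variational, p.286, (152) p.301] -/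
def IsLevWeight (w : ℕ → PBond P 0 → ℝ) : Prop :=
  ∀ m b, w m b = ((P.L : ℝ) ^ levOf (fun j => {x : Site P 0 | D.InOm j x}) k b.src * ((P.L : ℝ)⁻¹) ^ k) ^ m

/-- **PINNING `H`**: the plain-function operator `H` IS print's `GQ*(QGQ*)⁻¹` of the family `D` (`hOp (GE D) (QsE D) (EE D)`, lattice factor `L^k = η⁻¹`, `a ≡ 1`).
[cite: Balaban1985Variational, (45) p.285, (157) p.302; Balaban1984PropagatorsII, (2.35) p.228] -/
def IsFlatH (H : (BondIdx D → ℝ) →ₗ[ℝ] (PBond P 0 → ℝ)) : Prop :=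
  ∀ (X : BondIdx D → ℝ) (b : PBond P 0),
    H X b = hOp (GE D (c := (P.L : ℝ) ^ k) (pow_ne_zero _ (Nat.cast_ne_zero.2 P.L_pos.ne')) (w := fun _ => (1 : ℝ)) (fun _ => one_pos))
      (QsE D) (EE D (c := (P.L : ℝ) ^ k) (pow_ne_zero _ (Nat.cast_ne_zero.2 P.L_pos.ne')) (w := fun _ => (1 : ℝ)) (fun _ => one_pos))
      (WithLp.toLp 2 X) b

/-- **PINNING `G̃`**: the plain-function operator `Gt` IS `G − HQG` of the family `D` (`a ≡ 1`; canonical by `FlatCubeOperators.Gt_eq_Gt`).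
[cite: Balaban1985Variational, (143) p.300, (158) p.302] -/
def IsFlatGt (Gt : (PBond P 0 → ℝ) →ₗ[ℝ] (PBond P 0 → ℝ)) : Prop :=
  ∀ (f : PBond P 0 → ℝ) (b : PBond P 0),
    Gt f b = (GE D (c := (P.L : ℝ) ^ k) (pow_ne_zero _ (Nat.cast_ne_zero.2 P.L_pos.ne')) (w := fun _ => (1 : ℝ)) (fun _ => one_pos)
      - hOp (GE D (c := (P.L : ℝ) ^ k) (pow_ne_zero _ (Nat.cast_ne_zero.2 P.L_pos.ne')) (w := fun _ => (1 : ℝ)) (fun _ => one_pos))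
          (QsE D) (EE D (c := (P.L : ℝ) ^ k) (pow_ne_zero _ (Nat.cast_ne_zero.2 P.L_pos.ne')) (w := fun _ => (1 : ℝ)) (fun _ => one_pos))
        ∘ₗ QE D ∘ₗ GE D (c := (P.L : ℝ) ^ k) (pow_ne_zero _ (Nat.cast_ne_zero.2 P.L_pos.ne')) (w := fun _ => (1 : ℝ)) (fun _ => one_pos))
      (WithLp.toLp 2 f) b

/-- **PRINT'S `H = GQ*(QGQ*)⁻¹` OF THE FAMILY `D` ON PLAIN FUNCTIONS** (lattice factor `L^k = η⁻¹`, auxiliary weights `a ≡ 1`; canonical: any positive weights give the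
same operator, `FlatCubeOperators.hOp_eq_hOp`) — `FlatOpsLettersAssembly.flatH` with the carrier generalised. [cite: Balaban1985Variational, (45) p.285, (157) p.302; Balaban1984PropagatorsII, (2.35) p.228] -/
def flatH : (BondIdx D → ℝ) →ₗ[ℝ] (PBond P 0 → ℝ) :=
  (WithLp.linearEquiv 2 ℝ (PBond P 0 → ℝ)).toLinearMap ∘ₗ
    hOp (GE D (c := (P.L : ℝ) ^ k) (pow_ne_zero _ (Nat.cast_ne_zero.2 P.L_pos.ne')) (w := fun _ => (1 : ℝ)) (fun _ => one_pos))
      (QsE D) (EE D (c := (P.L : ℝ) ^ k) (pow_ne_zero _ (Nat.cast_ne_zero.2 P.L_pos.ne')) (w := fun _ => (1 : ℝ)) (fun _ => one_pos)) ∘ₗ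
    (WithLp.linearEquiv 2 ℝ (BondIdx D → ℝ)).symm.toLinearMap

/-- `flatH` IS the pinned `H` (`IsFlatH`, by `rfl`). [cite: Balaban1985Variational, (157) p.302] -/
theorem isFlatH_flatH : IsFlatH P k D (flatH P k D) := fun _ _ => rfl

/-- **PINNING A PLAIN-FUNCTION `G` TO THE GENUINE PROPAGATOR `G = Δ_a⁻¹ = GE D` WITH AN ARBITRARY POSITIVE WEIGHT FAMILY `w′`** (print's `a`, the band (2.16); lattice
factor `L^k`). [cite: Balaban1984PropagatorsII, (2.16) p.225, (2.19)-(2.22) p.226] -/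
def IsFlatGW {w' : BondIdx D → ℝ} (hw' : ∀ i, 0 < w' i) (G : (PBond P 0 → ℝ) →ₗ[ℝ] (PBond P 0 → ℝ)) : Prop :=
  ∀ (f : PBond P 0 → ℝ) (b : PBond P 0),
    G f b = GE D (c := (P.L : ℝ) ^ k) (pow_ne_zero _ (Nat.cast_ne_zero.2 P.L_pos.ne')) (w := w') hw' (WithLp.toLp 2 f) b

/-- **`G̃ := G − HQG` ON PLAIN FUNCTIONS** for a plain-function `G` (to be pinned by `IsFlatGW`) and the canonical `flatH`.
[cite: Balaban1985Variational, (143) p.300, (158) p.302] -/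
def gtOf (G : (PBond P 0 → ℝ) →ₗ[ℝ] (PBond P 0 → ℝ)) : (PBond P 0 → ℝ) →ₗ[ℝ] (PBond P 0 → ℝ) :=
  G - flatH P k D ∘ₗ Qfun D ∘ₗ G

/-- components of `G̃f = Gf − H(Q(Gf))`. [cite: Balaban1985Variational, (143) p.300] -/
theorem gtOf_apply (G : (PBond P 0 → ℝ) →ₗ[ℝ] (PBond P 0 → ℝ)) (f : PBond P 0 → ℝ) (b : PBond P 0) :
    gtOf P k D G f b = G f b - flatH P k D (Qfun D (G f)) b := by
  simp [gtOf]

/-- **`G̃` BUILT FROM A PINNED `G` IS THE PINNED `G̃`**: if `G` is the genuine propagator with SOME positive weights `w′`, then `gtOf … G` is `IsFlatGt` (the `a ≡ 1`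
formula) — by the canonicity `FlatCubeOperators.Gt_eq_Gt`∕`hOp_eq_hOp`. [cite: Balaban1985Variational, (143) p.300; Balaban1984PropagatorsII, (2.35) p.228] -/
theorem isFlatGt_gtOf {w' : BondIdx D → ℝ} (hw' : ∀ i, 0 < w' i) {G : (PBond P 0 → ℝ) →ₗ[ℝ] (PBond P 0 → ℝ)}
    (hG : IsFlatGW P k D hw' G) : IsFlatGt P k D (gtOf P k D G) := by
  intro f b
  have hc : ((P.L : ℝ) ^ k) ≠ 0 := pow_ne_zero _ (Nat.cast_ne_zero.2 P.L_pos.ne')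
  have hGf : WithLp.toLp 2 (G f) = GE D hc hw' (WithLp.toLp 2 f) := by
    ext b'
    exact hG f b'
  rw [gtOf_apply, FlatCubeOperators.Gt_eq_Gt D hc (fun _ => one_pos) hw' (WithLp.toLp 2 f)]
  simp only [LinearMap.sub_apply, LinearMap.comp_apply]
  rw [← FlatCubeOperators.hOp_eq_hOp D hc (fun _ => one_pos) hw', ← hGf, hG f b, ← hGf]
  rfl

end Pinning

/-! ## §2 The letter schemas of the text, generic carrier -/

section Letters

variable (P : Params) (k : ℕ) (D : Domains P)

/-- **(H-i) = (46), GUARDED** (`0 ≤ t`): `(L^{j(b)}η)|HX(b)| ≤ B₀·sup_c (L^{j(c)}η)|X(c)|` and the gradient `(L^{j(b)}η)²|∇^η(HX)(b)| ≤ B₀·sup_c (L^{j(c)}η)|X(c)|`, every direction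
`ν : Fin P.d`. [cite: Balaban1985Variational, (46) p.285] -/
def HSupLetterG (w : ℕ → PBond P 0 → ℝ) (H : (BondIdx D → ℝ) →ₗ[ℝ] (PBond P 0 → ℝ)) (B₀ : ℝ) : Prop :=
  ∀ (X : BondIdx D → ℝ) (t : ℝ), 0 ≤ t → (∀ c, ((P.L : ℝ) ^ ((c.1.1 : ℕ)) * ((P.L : ℝ)⁻¹) ^ k) * |X c| ≤ t) →
    (∀ b, w 1 b * |H X b| ≤ B₀ * t) ∧
    ∀ (b : PBond P 0) (ν : Fin P.d), w 2 b * (P.L : ℝ) ^ k * |H X ⟨b.src.shift ν, b.dir⟩ - H X b| ≤ B₀ * t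

/-- **(H-ii) = (161)₁ OVER AN ABSTRACT DISTANCE `dBI`, THE FOUR DECAYING ROWS** `|HB|, |∇^ηHB|, |∂^{η*}∂^ηHB|, |Δ^ηHB| ≤ B₀Σ_c e^{−δ₀d(b,c)}|X(c)|` (left sides level-weighted by
`w 1`, `w 2`, `w 3`, `w 3`; `∂*∂` = p21's `dcsE c (dcE c ·)`, `c = L^k`; `Δ` = the componentwise second-difference sum over `Fin P.d` × `(L^k)²`); the physical distance is the
instance `dBI := distBI D`. [cite: Balaban1985Variational, (161) p.303; Balaban1984PropagatorsII, Cor. 2.8 (2.150)-(2.151) p.249, (2.46) p.231] -/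
def HDecayLetterD (dBI : PBond P 0 → BondIdx D → ℝ) (w : ℕ → PBond P 0 → ℝ) (H : (BondIdx D → ℝ) →ₗ[ℝ] (PBond P 0 → ℝ)) (B₀ δ₀ : ℝ) : Prop :=
  ∀ (X : BondIdx D → ℝ) (b : PBond P 0),
    w 1 b * |H X b| ≤ B₀ * ∑ c, Real.exp (-(δ₀ * dBI b c)) * |X c| ∧
    (∀ ν : Fin P.d, w 2 b * (P.L : ℝ) ^ k * |H X ⟨b.src.shift ν, b.dir⟩ - H X b| ≤ B₀ * ∑ c, Real.exp (-(δ₀ * dBI b c)) * |X c|) ∧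
    w 3 b * |(dcsE ((P.L : ℝ) ^ k) (dcE ((P.L : ℝ) ^ k) (WithLp.toLp 2 (H X)))) b| ≤ B₀ * ∑ c, Real.exp (-(δ₀ * dBI b c)) * |X c| ∧
    w 3 b * ((P.L : ℝ) ^ k) ^ 2 * |∑ ν : Fin P.d, ((H X b - H X ⟨b.src.shift ν, b.dir⟩) + (H X b - H X ⟨b.src.unshift ν, b.dir⟩))| ≤
      B₀ * ∑ c, Real.exp (-(δ₀ * dBI b c)) * |X c|

/-- **(162) AS A LEFT-WEIGHTED ROW SUM**: `(L^{j(b)}η)·Σ_c e^{−½δ₀d(b,c)}(d(b,c) + 1)(L^{j(c)}η)⁻¹ ≤ B₃` at EVERY fine bond `b` (at `j(b) = k` this is (162) verbatim).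
[cite: Balaban1985Variational, (162) p.303] -/
def RowSum162 (dBI : PBond P 0 → BondIdx D → ℝ) (w : ℕ → PBond P 0 → ℝ) (δ₀ B₃ : ℝ) : Prop :=
  ∀ b, w 1 b * ∑ c, Real.exp (-(δ₀ / 2 * dBI b c)) * (dBI b c + 1) * (P.L : ℝ) ^ (k - (c.1.1 : ℕ)) ≤ B₃

/-- **THE LAPLACIAN SUP ROW OF `H`** = (130) at `U₀ = 1`: for data `(L^{j(c)}η)|X(c)| ≤ t` (`0 ≤ t`), `(L^{j(b)}η)³·η⁻²·|(ΔHX)(b)| ≤ B₀·t`.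
[cite: Balaban1985Variational, (130) p.298, (137)-(140) p.298-299] -/
def HLapLetterG (w : ℕ → PBond P 0 → ℝ) (H : (BondIdx D → ℝ) →ₗ[ℝ] (PBond P 0 → ℝ)) (B₀ : ℝ) : Prop :=
  ∀ (X : BondIdx D → ℝ) (t : ℝ), 0 ≤ t → (∀ c, ((P.L : ℝ) ^ ((c.1.1 : ℕ)) * ((P.L : ℝ)⁻¹) ^ k) * |X c| ≤ t) →
    ∀ (b : PBond P 0),
      w 3 b * ((P.L : ℝ) ^ k) ^ 2 * |∑ ν : Fin P.d, ((H X b - H X ⟨b.src.shift ν, b.dir⟩) + (H X b - H X ⟨b.src.unshift ν, b.dir⟩))| ≤ B₀ * t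

/-- **(G̃-i), GUARDED** (`0 ≤ β`) — the F4 pen's `hG` shape «current size `f` ≤ β ⇒ size `G̃f` ≤ B₀β» (`w 3 → w 1`, `w 2·L^k` gradient, every direction `ν : Fin P.d`).
[cite: Balaban1985Variational, (158) p.302, (165) p.304; Balaban1984PropagatorsII, Prop. 2.2 (2.47)-(2.51) p.231] -/
def GtSupLetterG (w : ℕ → PBond P 0 → ℝ) (Gt : (PBond P 0 → ℝ) →ₗ[ℝ] (PBond P 0 → ℝ)) (B₀ : ℝ) : Prop :=
  ∀ (f : PBond P 0 → ℝ) (β : ℝ), 0 ≤ β → (∀ b, w 3 b * |f b| ≤ β) →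
    (∀ b, w 1 b * |Gt f b| ≤ B₀ * β) ∧
    ∀ (b : PBond P 0) (ν : Fin P.d), w 2 b * (P.L : ℝ) ^ k * |Gt f ⟨b.src.shift ν, b.dir⟩ - Gt f b| ≤ B₀ * β

/-- **(G̃-ii), LAPLACIAN ROW, GUARDED** (the `Δ` row of the second-order letters of (165); the `∂*∂G̃` sup row is false and is NOT a letter — UST VET g2 V1).
[cite: Balaban1985Variational, (165) p.304; Balaban1984PropagatorsII, Prop. 2.6 (2.136) p.247] -/
def GtLaplaceLetterG (w : ℕ → PBond P 0 → ℝ) (Gt : (PBond P 0 → ℝ) →ₗ[ℝ] (PBond P 0 → ℝ)) (B₀ : ℝ) : Prop :=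
  ∀ (f : PBond P 0 → ℝ) (β : ℝ), 0 ≤ β → (∀ b, w 3 b * |f b| ≤ β) →
    ∀ (b : PBond P 0),
      w 3 b * ((P.L : ℝ) ^ k) ^ 2 * |∑ ν : Fin P.d, ((Gt f b - Gt f ⟨b.src.shift ν, b.dir⟩) + (Gt f b - Gt f ⟨b.src.unshift ν, b.dir⟩))| ≤ B₀ * β

/-- **THE CONTRACTION ROW OF THE AVERAGING `Q`** (lattice geometry): for a fine bond function with `(L^{j(b)}η)|u(b)| ≤ r` (`0 ≤ r`), the index-bond data `Qu` has
`(L^{j(c)}η)|(Qu)(c)| ≤ C_Q·r`. [cite: Balaban1984PropagatorsI, (1.11) p.19, (1.18) p.20; Balaban1984PropagatorsII, (2.20) p.226] -/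
def QContrLetter (w : ℕ → PBond P 0 → ℝ) (CQ : ℝ) : Prop :=
  ∀ (u : PBond P 0 → ℝ) (r : ℝ), 0 ≤ r → (∀ b, w 1 b * |u b| ≤ r) →
    ∀ c : BondIdx D, ((P.L : ℝ) ^ ((c.1.1 : ℕ)) * ((P.L : ℝ)⁻¹) ^ k) * |Qfun D u c| ≤ CQ * r

/-- **THE KERNEL ROWS OF `H` OVER A DISTANCE `dBI`** (entries of `H` against indicator data `e_c`, read at the fine bond `b`): (k1) `|(He_c)(b)| ≤ C·e^{−δ·dBI(b,c)}`,
(k2) `(L^{j(b)}η)·η⁻¹·|(He_c)(b+e_ν) − (He_c)(b)| ≤ C·e^{−δ·dBI(b,c)}` ((2.151)₁,₂ with the (2.150) volume weight), (k3) `(L^{j(b)}η)³·|(∂^{η*}∂^ηHe_c)(b)| ≤ C·e^{−δ·dBI(b,c)}`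
((139)–(140), kernel form), (k4) `(L^{j(b)}η)²·η⁻²·|(ΔHe_c)(b)| ≤ C·e^{−δ·dBI(b,c)}` ((130) ∘ (2.60)). [cite: Balaban1984PropagatorsII, Cor. 2.8 (2.150)-(2.151) p.249; Balaban1985Variational, (130) p.298, (139)-(140) p.299] -/
def HKernelRows (dBI : PBond P 0 → BondIdx D → ℝ) (w : ℕ → PBond P 0 → ℝ) (H : (BondIdx D → ℝ) →ₗ[ℝ] (PBond P 0 → ℝ)) (C δ : ℝ) : Prop :=
  ∀ (c : BondIdx D) (e : BondIdx D → ℝ), e c = 1 → (∀ c', c' ≠ c → e c' = 0) → ∀ b : PBond P 0,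
    |H e b| ≤ C * Real.exp (-(δ * dBI b c)) ∧
    (∀ ν : Fin P.d, w 1 b * (P.L : ℝ) ^ k * |H e ⟨b.src.shift ν, b.dir⟩ - H e b| ≤ C * Real.exp (-(δ * dBI b c))) ∧
    w 3 b * |(dcsE ((P.L : ℝ) ^ k) (dcE ((P.L : ℝ) ^ k) (WithLp.toLp 2 (H e)))) b| ≤ C * Real.exp (-(δ * dBI b c)) ∧
    w 2 b * ((P.L : ℝ) ^ k) ^ 2 * |∑ ν : Fin P.d, ((H e b - H e ⟨b.src.shift ν, b.dir⟩) + (H e b - H e ⟨b.src.unshift ν, b.dir⟩))| ≤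
      C * Real.exp (-(δ * dBI b c))

end Letters

/-! ## §3 The row lists and the body at one datum, generic carrier -/

section Lists

variable (P : Params) (k : ℕ) (D : Domains P)

/-- **THE PORT-SHAPED INPUT AT ONE DATUM** (`FlatOpsFromKernelRows.KernelRowsAt`, carrier generalised): (H) a distance `dBI ≥ distBI` with the (162) row sum and the four
kernel rows of the canonical `flatH` at rate `δ₀`; (G) the genuine `G = Δ_a⁻¹` with some positive weights and its (2.136)₁,₂,₄ operator rows, constant `C_G`.
[cite: Balaban1984PropagatorsII, Prop. 2.6 (2.136) p.247, Cor. 2.8 (2.150)-(2.151) p.249, (2.46) p.231; Balaban1985Variational, (130) p.298, (139)-(140) p.299, (162) p.303] -/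
def KernelRowsAt (w : ℕ → PBond P 0 → ℝ) (C δ₀ B₃ CG : ℝ) : Prop :=
  (∃ dBI : PBond P 0 → BondIdx D → ℝ,
      (∀ b c, distBI D b c ≤ dBI b c) ∧ RowSum162 P k D dBI w δ₀ B₃ ∧ HKernelRows P k D dBI w (flatH P k D) C δ₀) ∧
  ∃ (w' : BondIdx D → ℝ) (hw' : ∀ i, 0 < w' i) (G : (PBond P 0 → ℝ) →ₗ[ℝ] (PBond P 0 → ℝ)),
    IsFlatGW P k D hw' G ∧ GtSupLetterG P k w G CG ∧ GtLaplaceLetterG P k w G CG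

/-- **THE `H`-HALF OF THE ROW LIST AT ONE DATUM** — what Sect. F's (161)–(164) consume (S5): for the canonical `flatH`, the guarded (46) letter, the (130) Laplacian row,
and a distance `dBI ≥ distBI` carrying the (162) row sum and the four (161)₁ rows. [cite: Balaban1985Variational, (46) p.285, (130) p.298, (161)-(162) p.303; Balaban1984PropagatorsII, Cor. 2.8 (2.150)-(2.151) p.249, (2.46) p.231] -/
def HRowsAt (w : ℕ → PBond P 0 → ℝ) (B₀ δ₀ B₃ : ℝ) : Prop :=
  HSupLetterG P k D w (flatH P k D) B₀ ∧ HLapLetterG P k D w (flatH P k D) B₀ ∧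
    ∃ dBI : PBond P 0 → BondIdx D → ℝ,
      (∀ b c, distBI D b c ≤ dBI b c) ∧ RowSum162 P k D dBI w δ₀ B₃ ∧ HDecayLetterD P k D dBI w (flatH P k D) B₀ δ₀

/-- **THE INPUT ROW LIST AT ONE DATUM** (`FlatOpsLettersAssembly.RowsAt`, carrier generalised): the `H`-half `HRowsAt`, (G) the genuine `G = Δ_a⁻¹` with SOME positive
weights and its rows through the `GtSupLetterG`∕`GtLaplaceLetterG` shapes (constant `C_G`), (Q) the contraction row (constant `C_Q`).
[cite: Balaban1984PropagatorsII, Prop. 2.6 (2.136) p.247, Cor. 2.8 (2.150)-(2.151) p.249, (2.46) p.231; Balaban1985Variational, (46) p.285, (130) p.298, (161)-(163) p.303] -/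
def RowsAt (w : ℕ → PBond P 0 → ℝ) (B₀ δ₀ B₃ CG CQ : ℝ) : Prop :=
  HRowsAt P k D w B₀ δ₀ B₃ ∧
  (∃ (w' : BondIdx D → ℝ) (hw' : ∀ i, 0 < w' i) (G : (PBond P 0 → ℝ) →ₗ[ℝ] (PBond P 0 → ℝ)),
      IsFlatGW P k D hw' G ∧ GtSupLetterG P k w G CG ∧ GtLaplaceLetterG P k w G CG) ∧
  QContrLetter P k D w CQ

/-- **THE BODY OF THE P2 TEXT AT ONE DATUM** (the `∃ H G̃ … ∃ dBI …` clause of `FlatCubeOpsText.FlatOpsAdmAtMS`, carrier generalised): THERE ARE the canonical operators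
`H`, `G̃` (pinned by `IsFlatH`∕`IsFlatGt`) with the guarded (46)∕`hG` letters, the Laplacian letter of (165), and a distance `dBI ≥ distBI` under which the (162) row sum
(rate `δ₀∕2`, bound `B₃`) holds and the four (161)₁ rows decay at rate `δ₀`. [cite: Balaban1985Variational, (46) p.285, (161)-(163) p.303, (165) p.304; Balaban1984PropagatorsII, (2.46) p.231, Prop. 2.6 (2.136) p.247, Prop. 2.7 (2.149)/Cor. 2.8 (2.150)–(2.151) p.249] -/
def BodyAt (w : ℕ → PBond P 0 → ℝ) (B₀ δ₀ B₃ : ℝ) : Prop :=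
  ∃ (H : (BondIdx D → ℝ) →ₗ[ℝ] (PBond P 0 → ℝ)) (Gt : (PBond P 0 → ℝ) →ₗ[ℝ] (PBond P 0 → ℝ)),
    IsFlatH P k D H ∧ IsFlatGt P k D Gt ∧
    HSupLetterG P k D w H B₀ ∧ GtSupLetterG P k w Gt B₀ ∧ GtLaplaceLetterG P k w Gt B₀ ∧
    ∃ dBI : PBond P 0 → BondIdx D → ℝ,
      (∀ b c, distBI D b c ≤ dBI b c) ∧ RowSum162 P k D dBI w δ₀ B₃ ∧ HDecayLetterD P k D dBI w H B₀ δ₀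

variable {P k D}

/-- the `H`-half of a row list. [cite: Balaban1985Variational, (161)-(162) p.303] -/
theorem RowsAt.hRowsAt {w : ℕ → PBond P 0 → ℝ} {B₀ δ₀ B₃ CG CQ : ℝ} (h : RowsAt P k D w B₀ δ₀ B₃ CG CQ) : HRowsAt P k D w B₀ δ₀ B₃ :=
  h.1

end Lists

/-! ## §5 The d = 3 letters of `FlatCubeOpsText` ∕ `FlatOpsLettersAssembly` ∕ `FlatOpsHRowsFromKernels` ∕ `FlatOpsFromKernelRows` ARE the instances `P := F.P K`, `k := K − n`

Every bridge is `Iff.rfl` ∕ `rfl`: `(F.P K).L` unfolds to `F.L`, `(F.P K).d` to `3`. -/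

section BridgeT3

variable (F : T3Family) (n K : ℕ) (D : Domains (F.P K))

/-- the d = 3 level weights are the instance. [cite: Balaban1985Variational, p.286] -/
theorem isLevWeight_iff_T3 (w : ℕ → PBond (F.P K) 0 → ℝ) : IsLevWeight (F.P K) (K - n) D w ↔ FlatCubeOpsText.IsLevWeight F n K D w := Iff.rfl

/-- the d = 3 pinning of `H` is the instance. [cite: Balaban1985Variational, (157) p.302] -/
theorem isFlatH_iff_T3 (H : (BondIdx D → ℝ) →ₗ[ℝ] (PBond (F.P K) 0 → ℝ)) : IsFlatH (F.P K) (K - n) D H ↔ FlatCubeOpsText.IsFlatH F n K D H := Iff.rfl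

/-- the d = 3 pinning of `G̃` is the instance. [cite: Balaban1985Variational, (143) p.300] -/
theorem isFlatGt_iff_T3 (Gt : (PBond (F.P K) 0 → ℝ) →ₗ[ℝ] (PBond (F.P K) 0 → ℝ)) : IsFlatGt (F.P K) (K - n) D Gt ↔ FlatCubeOpsText.IsFlatGt F n K D Gt :=
  Iff.rfl

/-- the d = 3 canonical `H` is the instance. [cite: Balaban1985Variational, (157) p.302] -/
theorem flatH_eq_T3 : flatH (F.P K) (K - n) D = FlatOpsLettersAssembly.flatH F n K D := rfl

/-- the d = 3 pinning of `G` is the instance. [cite: Balaban1984PropagatorsII, (2.16) p.225] -/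
theorem isFlatGW_iff_T3 {w' : BondIdx D → ℝ} (hw' : ∀ i, 0 < w' i) (G : (PBond (F.P K) 0 → ℝ) →ₗ[ℝ] (PBond (F.P K) 0 → ℝ)) :
    IsFlatGW (F.P K) (K - n) D hw' G ↔ FlatOpsLettersAssembly.IsFlatGW F n K D hw' G := Iff.rfl

/-- the d = 3 `G̃ := G − HQG` is the instance. [cite: Balaban1985Variational, (143) p.300] -/
theorem gtOf_eq_T3 (G : (PBond (F.P K) 0 → ℝ) →ₗ[ℝ] (PBond (F.P K) 0 → ℝ)) : gtOf (F.P K) (K - n) D G = FlatOpsLettersAssembly.gtOf F n K D G := rfl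

/-- the d = 3 (46) letter is the instance. [cite: Balaban1985Variational, (46) p.285] -/
theorem hSupLetterG_iff_T3 (w : ℕ → PBond (F.P K) 0 → ℝ) (H : (BondIdx D → ℝ) →ₗ[ℝ] (PBond (F.P K) 0 → ℝ)) (B₀ : ℝ) :
    HSupLetterG (F.P K) (K - n) D w H B₀ ↔ FlatCubeOpsText.HSupLetterG F n K D w H B₀ := Iff.rfl

/-- the d = 3 (161)₁ letter is the instance. [cite: Balaban1985Variational, (161) p.303] -/
theorem hDecayLetterD_iff_T3 (dBI : PBond (F.P K) 0 → BondIdx D → ℝ) (w : ℕ → PBond (F.P K) 0 → ℝ) (H : (BondIdx D → ℝ) →ₗ[ℝ] (PBond (F.P K) 0 → ℝ))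
    (B₀ δ₀ : ℝ) : HDecayLetterD (F.P K) (K - n) D dBI w H B₀ δ₀ ↔ FlatCubeOpsText.HDecayLetterD F n K D dBI w H B₀ δ₀ := Iff.rfl

/-- the d = 3 (162) row sum is the instance. [cite: Balaban1985Variational, (162) p.303] -/
theorem rowSum162_iff_T3 (dBI : PBond (F.P K) 0 → BondIdx D → ℝ) (w : ℕ → PBond (F.P K) 0 → ℝ) (δ₀ B₃ : ℝ) :
    RowSum162 (F.P K) (K - n) D dBI w δ₀ B₃ ↔ FlatCubeOpsText.RowSum162 F n K D dBI w δ₀ B₃ := Iff.rfl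

/-- the d = 3 (130) letter is the instance. [cite: Balaban1985Variational, (130) p.298] -/
theorem hLapLetterG_iff_T3 (w : ℕ → PBond (F.P K) 0 → ℝ) (H : (BondIdx D → ℝ) →ₗ[ℝ] (PBond (F.P K) 0 → ℝ)) (B₀ : ℝ) :
    HLapLetterG (F.P K) (K - n) D w H B₀ ↔ FlatOpsLettersAssembly.HLapLetterG F n K D w H B₀ := Iff.rfl

/-- the d = 3 `hG` letter is the instance. [cite: Balaban1985Variational, (165) p.304] -/
theorem gtSupLetterG_iff_T3 (w : ℕ → PBond (F.P K) 0 → ℝ) (Gt : (PBond (F.P K) 0 → ℝ) →ₗ[ℝ] (PBond (F.P K) 0 → ℝ)) (B₀ : ℝ) :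
    GtSupLetterG (F.P K) (K - n) w Gt B₀ ↔ FlatCubeOpsText.GtSupLetterG F n K w Gt B₀ := Iff.rfl

/-- the d = 3 Laplacian letter of `G̃` is the instance. [cite: Balaban1985Variational, (165) p.304] -/
theorem gtLaplaceLetterG_iff_T3 (w : ℕ → PBond (F.P K) 0 → ℝ) (Gt : (PBond (F.P K) 0 → ℝ) →ₗ[ℝ] (PBond (F.P K) 0 → ℝ)) (B₀ : ℝ) :
    GtLaplaceLetterG (F.P K) (K - n) w Gt B₀ ↔ FlatCubeOpsText.GtLaplaceLetterG F n K w Gt B₀ := Iff.rfl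

/-- the d = 3 contraction row is the instance. [cite: Balaban1984PropagatorsII, (2.20) p.226] -/
theorem qContrLetter_iff_T3 (w : ℕ → PBond (F.P K) 0 → ℝ) (CQ : ℝ) :
    QContrLetter (F.P K) (K - n) D w CQ ↔ FlatOpsLettersAssembly.QContrLetter F n K D w CQ := Iff.rfl

/-- the d = 3 kernel rows are the instance. [cite: Balaban1984PropagatorsII, Cor. 2.8 (2.150)-(2.151) p.249] -/
theorem hKernelRows_iff_T3 (dBI : PBond (F.P K) 0 → BondIdx D → ℝ) (w : ℕ → PBond (F.P K) 0 → ℝ) (H : (BondIdx D → ℝ) →ₗ[ℝ] (PBond (F.P K) 0 → ℝ))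
    (C δ : ℝ) : HKernelRows (F.P K) (K - n) D dBI w H C δ ↔ FlatOpsHRowsFromKernels.HKernelRows F n K D dBI w H C δ := Iff.rfl

/-- the d = 3 port-shaped input is the instance. [cite: Balaban1984PropagatorsII, Cor. 2.8 (2.150)-(2.151) p.249] -/
theorem kernelRowsAt_iff_T3 (w : ℕ → PBond (F.P K) 0 → ℝ) (C δ₀ B₃ CG : ℝ) :
    KernelRowsAt (F.P K) (K - n) D w C δ₀ B₃ CG ↔ FlatOpsFromKernelRows.KernelRowsAt F n K D w C δ₀ B₃ CG := Iff.rfl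

/-- the d = 3 row list is the instance. [cite: Balaban1985Variational, (46) p.285, (161)-(162) p.303] -/
theorem rowsAt_iff_T3 (w : ℕ → PBond (F.P K) 0 → ℝ) (B₀ δ₀ B₃ CG CQ : ℝ) :
    RowsAt (F.P K) (K - n) D w B₀ δ₀ B₃ CG CQ ↔ FlatOpsLettersAssembly.RowsAt F n K D w B₀ δ₀ B₃ CG CQ := Iff.rfl

end BridgeT3

/-! ## §6 The d = 4 carrier: NODE 00's tori `T4Family.P K` ARE lit-balaban's `PV 3 ℓ m K` -/

section CarrierT4

/-- `1 ≤ 3 + 1` (named once). [folklore] -/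
theorem hd4 : 1 ≤ 3 + 1 := by norm_num

/-- **`Missing.params4 (ℓ+1) = PV 3 ℓ`**: the d = 4 parameters of [Balaban1987RG1] (0.1) ARE lit-balaban's generic-`d` V1-torus parameters at `d + 1 = 4` (by `rfl`).
[cite: Balaban1987RG1, (0.1) p.251] -/
theorem params4_eq_PV (ℓ : ℕ) (hL : Odd (ℓ + 1) ∧ 1 < ℓ + 1) (m K : ℕ) : Missing.params4 (ℓ + 1) hL m K = PV 3 ℓ m K hd4 hL := rfl

/-- **`T4Family.P = PV 3`**: the `K`-th lattice approximation of the four-torus `⟨ℓ+1, hL, h11, m, hm⟩` IS `PV 3 ℓ m K` (by `rfl`) — so every row lit-balaban states on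
`PV d ℓ m K` at `d = 3` is a row on NODE 00's carrier. [cite: Balaban1987RG1, (0.1) p.251] -/
theorem P_mk_eq_PV (ℓ : ℕ) (hL : Odd (ℓ + 1) ∧ 1 < ℓ + 1) (h11 : 11 < ℓ + 1) (m : ℕ) (hm : 1 ≤ m) (K : ℕ) :
    (⟨ℓ + 1, hL, h11, m, hm⟩ : T4Family).P K = PV 3 ℓ m K hd4 hL := rfl

/-- every four-torus family member is of the form `⟨ℓ + 1, …⟩` with `4 ≤ ℓ` (indeed `11 ≤ ℓ`): the range on which lit-balaban's k-level rows (`4 ≤ ℓ`) are stated.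
[cite: Balaban1987RG1, (0.1) p.251] -/
theorem exists_L_eq_succ (F : T4Family) : ∃ ℓ : ℕ, F.L = ℓ + 1 ∧ 4 ≤ ℓ := by
  refine ⟨F.L - 1, ?_, ?_⟩ <;> have := F.hL11 <;> omega

end CarrierT4

/-! ## §7 Bookkeeping: the level weights are nonnegative; monotonicity of the letters in their constants -/

section Mono

variable {P : Params} {k : ℕ} {D : Domains P} {w : ℕ → PBond P 0 → ℝ}

/-- the level weights are nonnegative. [cite: Balaban1985Variational, p.286] -/
theorem levWeight_nonneg (hw : IsLevWeight P k D w) (m : ℕ) (b : PBond P 0) : 0 ≤ w m b := by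
  rw [hw m b]
  exact pow_nonneg (mul_nonneg (pow_nonneg (Nat.cast_nonneg _) _) (pow_nonneg (inv_nonneg.2 (Nat.cast_nonneg _)) _)) _

/-- (46) is monotone in `B₀`. [cite: Balaban1985Variational, (46) p.285] -/
theorem hSupLetterG_mono {H : (BondIdx D → ℝ) →ₗ[ℝ] (PBond P 0 → ℝ)} {B B' : ℝ} (h : HSupLetterG P k D w H B) (hBB' : B ≤ B') :
    HSupLetterG P k D w H B' := by
  intro X t ht hX
  obtain ⟨h1, h2⟩ := h X t ht hX
  exact ⟨fun b => (h1 b).trans (mul_le_mul_of_nonneg_right hBB' ht), fun b ν => (h2 b ν).trans (mul_le_mul_of_nonneg_right hBB' ht)⟩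

/-- (130) is monotone in `B₀`. [cite: Balaban1985Variational, (130) p.298] -/
theorem hLapLetterG_mono {H : (BondIdx D → ℝ) →ₗ[ℝ] (PBond P 0 → ℝ)} {B B' : ℝ} (h : HLapLetterG P k D w H B) (hBB' : B ≤ B') :
    HLapLetterG P k D w H B' :=
  fun X t ht hX b => (h X t ht hX b).trans (mul_le_mul_of_nonneg_right hBB' ht)

/-- `hG` is monotone in `B₀`. [cite: Balaban1985Variational, (165) p.304] -/
theorem gtSupLetterG_mono {G : (PBond P 0 → ℝ) →ₗ[ℝ] (PBond P 0 → ℝ)} {B B' : ℝ} (h : GtSupLetterG P k w G B) (hBB' : B ≤ B') :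
    GtSupLetterG P k w G B' := by
  intro f β hβ hf
  obtain ⟨h1, h2⟩ := h f β hβ hf
  exact ⟨fun b => (h1 b).trans (mul_le_mul_of_nonneg_right hBB' hβ), fun b ν => (h2 b ν).trans (mul_le_mul_of_nonneg_right hBB' hβ)⟩

/-- the Laplacian letter of `G̃` is monotone in `B₀`. [cite: Balaban1985Variational, (165) p.304] -/
theorem gtLaplaceLetterG_mono {G : (PBond P 0 → ℝ) →ₗ[ℝ] (PBond P 0 → ℝ)} {B B' : ℝ} (h : GtLaplaceLetterG P k w G B) (hBB' : B ≤ B') :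
    GtLaplaceLetterG P k w G B' :=
  fun f β hβ hf b => (h f β hβ hf b).trans (mul_le_mul_of_nonneg_right hBB' hβ)

/-- (161)₁ is monotone in `B₀` (the kernel sums are nonnegative). [cite: Balaban1985Variational, (161) p.303] -/
theorem hDecayLetterD_mono {dBI : PBond P 0 → BondIdx D → ℝ} {H : (BondIdx D → ℝ) →ₗ[ℝ] (PBond P 0 → ℝ)} {B B' δ₀ : ℝ}
    (h : HDecayLetterD P k D dBI w H B δ₀) (hBB' : B ≤ B') : HDecayLetterD P k D dBI w H B' δ₀ := by
  intro X b
  have hS : 0 ≤ ∑ c, Real.exp (-(δ₀ * dBI b c)) * |X c| :=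
    Finset.sum_nonneg fun c _ => mul_nonneg (Real.exp_nonneg _) (abs_nonneg _)
  obtain ⟨h1, h2, h3, h4⟩ := h X b
  exact ⟨h1.trans (mul_le_mul_of_nonneg_right hBB' hS), fun ν => (h2 ν).trans (mul_le_mul_of_nonneg_right hBB' hS),
    h3.trans (mul_le_mul_of_nonneg_right hBB' hS), h4.trans (mul_le_mul_of_nonneg_right hBB' hS)⟩

/-- the physical-distance instance of the four decaying rows dominates any `dBI ≥ distBI` instance at the same rate `δ₀ ≥ 0` (the (161) line-3 conversion
«|y₂ − y| ≤ d(y₁,y₂) + …» read as a comparison of distances). [cite: Balaban1985Variational, (161) p.303; Balaban1984PropagatorsII, (2.46) p.231] -/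
theorem hDecayLetterD_of_le {dBI dBI' : PBond P 0 → BondIdx D → ℝ} {H : (BondIdx D → ℝ) →ₗ[ℝ] (PBond P 0 → ℝ)} {B δ₀ : ℝ} (hB : 0 ≤ B) (hδ₀ : 0 ≤ δ₀)
    (hle : ∀ b c, dBI' b c ≤ dBI b c) (h : HDecayLetterD P k D dBI w H B δ₀) : HDecayLetterD P k D dBI' w H B δ₀ := by
  intro X b
  have hS : ∑ c, Real.exp (-(δ₀ * dBI b c)) * |X c| ≤ ∑ c, Real.exp (-(δ₀ * dBI' b c)) * |X c| :=
    Finset.sum_le_sum fun c _ => mul_le_mul_of_nonneg_right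
      (Real.exp_le_exp.2 (neg_le_neg (mul_le_mul_of_nonneg_left (hle b c) hδ₀))) (abs_nonneg _)
  have hBS := mul_le_mul_of_nonneg_left hS hB
  obtain ⟨h1, h2, h3, h4⟩ := h X b
  exact ⟨h1.trans hBS, fun ν => (h2 ν).trans hBS, h3.trans hBS, h4.trans hBS⟩

end Mono

end Summit.QuantumFields.YangMills.Theorems.K0FlatCubeOpsTextP

end
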